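import Summits.CriticalPhenomena.PercolationContinuityZ3.Theorems.Transplant.FKConnectivityAllQForestAdjacentPathGadgetResClass
import HarnessLib

/-!
# The path gadget: re-gluing a doubly-`pq` colouring; fibre counts along an injection

builds on p205010 (kernel theorem, internal audit signed; external expert review pending).  No definitions, no named facts, no sorries;
standard axioms.

Separator `S = {o, p, q}` with the PATH gadget `{op, oq}` (both free; memo bschramm/FROM-fk-1-g20-SEPARATOR-EXCHANGE.md §3).  The node's
inequality across such a separator is equivalent (`…SeparatorResidual`, `…PathGadgetResidual`) to `bad ≤ good` on the DOUBLY-`pq`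
residual colourings, which (`…PathGadgetResClass`) are of type `(d, pq | pq, d)` or `(pq, d | d, pq)` with one gadget pair in each class.
HYPOTHESES (the level-one sign facts of the two sides, as injections — memo §3(iii), §6 item 2): `J₁` maps the side-1 colourings of type
`(pq, d)` (first class contains `e`, joins exactly `p, q`; partner discrete) injectively to those of type `(d, pq)`; `J₂` maps the side-2
colourings of type `(pq, d)` with `f` in the first class injectively to those of type `(d, pq)` with `f` in the first class.
This file: `pathGadget_reglue` (validity of `X₁ ∪ {oc} ∪ Z` when one of `X₁ ⊆ E₁`, `Z ⊆ E₂` is discrete on `S` and the other joins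
exactly `p, q` — rank-one gluing `…GlueRankOne` or free gluing) and `fibreCount_le_of_injOn`; the injection itself is
`…PathGadgetProduct`.
[cite: Grimmett2006, §1.5 (p. 13); §3.8 (pp. 61–62); §4.2 Lemma (4.13)] [cite: SempleWelsh2008, Conj. 1.1 (p. 2)] [cite: Linusson2011, Prop. 2.6]
-/

noncomputable section

namespace Summit.CriticalPhenomena.PercolationContinuityZ3.Theorems

namespace FK

open Set SimpleGraph Literature.Probability.LatticeModels Literature.Probability.Percolation
open scoped Classical

variable {V : Type*} [Fintype V]

section PathGadgetReglue

open scoped symmDiff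

variable {E₁ E₂ : Set (Sym2 V)} {V₁ V₂ : Set V} {M u₀ : BondConfig V} {o p q v y : V}

/-- **Re-gluing a doubly-`pq` colouring** (validity).  `X₁ ⊆ E₁` and `Z ⊆ E₂` forests, one with discrete trace on `S` and the other
joining exactly `p, q`; `c ∈ {p, q}`.  Then `X₁ ∪ {oc} ∪ Z` is a forest (rank-one gluing, resp. free gluing).
[cite: Grimmett2006, §3.8 (pp. 61–62); §4.2 Lemma (4.13)] -/
theorem pathGadget_reglue (hop : o ≠ p) (hoq : o ≠ q) (hpq : p ≠ q)
    (h₁ : ∀ e ∈ E₁, ∀ z ∈ e, z ∈ V₁) (h₂ : ∀ e ∈ E₂, ∀ z ∈ e, z ∈ V₂) (hS : V₁ ∩ V₂ ⊆ ({o, p, q} : Set V))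
    (hd : Disjoint E₁ E₂) (hn₁ : ∀ x ∈ ({o, p, q} : Set V), ∀ x' ∈ ({o, p, q} : Set V), s(x, x') ∉ E₁)
    (hn₂ : ∀ x ∈ ({o, p, q} : Set V), ∀ x' ∈ ({o, p, q} : Set V), s(x, x') ∉ E₂)
    {X₁ Z : BondConfig V} {c : V} (hX₁ : X₁ ⊆ E₁) (hZ : Z ⊆ E₂) (hX₁F : IsForestCfg X₁) (hZF : IsForestCfg Z)
    (hc : c = p ∨ c = q)
    (htr : ((∀ x ∈ ({o, p, q} : Set V), ∀ x' ∈ ({o, p, q} : Set V), (openGraph X₁).Reachable x x' → x = x') ∧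
        (openGraph Z).Reachable p q ∧ ¬ (openGraph Z).Reachable o p ∧ ¬ (openGraph Z).Reachable o q) ∨
      (((openGraph X₁).Reachable p q ∧ ¬ (openGraph X₁).Reachable o p ∧ ¬ (openGraph X₁).Reachable o q) ∧
        ∀ x ∈ ({o, p, q} : Set V), ∀ x' ∈ ({o, p, q} : Set V), (openGraph Z).Reachable x x' → x = x')) :
    IsForestCfg (X₁ ∪ {s(o, c)} ∪ Z) := by
  have ho3 : o ∈ ({o, p, q} : Set V) := mem_insert _ _
  have hp3 : p ∈ ({o, p, q} : Set V) := mem_insert_of_mem _ (mem_insert _ _)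
  have hq3 : q ∈ ({o, p, q} : Set V) := mem_insert_of_mem _ (mem_insert_of_mem _ rfl)
  have hc3 : c ∈ ({o, p, q} : Set V) := by rcases hc with rfl | rfl; exacts [hp3, hq3]
  have hoc : o ≠ c := by rcases hc with rfl | rfl; exacts [hop, hoq]
  have hU : ∀ e ∈ X₁ ∪ {s(o, c)}, ∀ z ∈ e, z ∈ V₂ → z ∈ ({o, p, q} : Set V) := by
    rintro e (he | he) z hz hzV
    · exact hS ⟨h₁ e (hX₁ he) z hz, hzV⟩
    · rw [mem_singleton_iff.1 he] at hz
      rcases Sym2.mem_iff.1 hz with rfl | rfl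
      · exact ho3
      · exact hc3
  have hZon : ∀ e ∈ Z, ∀ z ∈ e, z ∈ V₂ := fun e he z hz => h₂ e (hZ he) z hz
  have hUZ : Disjoint (X₁ ∪ {s(o, c)}) Z := by
    refine Set.disjoint_left.2 ?_
    rintro x (hx | hx) hxZ
    · exact Set.disjoint_left.1 hd (hX₁ hx) (hZ hxZ)
    · rw [mem_singleton_iff.1 hx] at hxZ; exact hn₂ o ho3 c hc3 (hZ hxZ)
  have nZ : ∀ x x', x ∈ ({o, p, q} : Set V) → x' ∈ ({o, p, q} : Set V) → s(x, x') ∉ Z := fun x x' hx hx' h => hn₂ x hx x' hx' (hZ h)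
  have nX : ∀ x x', x ∈ ({o, p, q} : Set V) → x' ∈ ({o, p, q} : Set V) → s(x, x') ∉ X₁ := fun x x' hx hx' h => hn₁ x hx x' hx' (hX₁ h)
  have hocX : s(o, c) ∉ X₁ := nX o c ho3 hc3
  rcases htr with ⟨hXd, hZpq, hZop, hZoq⟩ | ⟨⟨hXpq, hXop, hXoq⟩, hZd⟩
  · -- `X₁` discrete, `Z` joins exactly `p, q`: rank-one gluing, forbidden pair `(o, p)`
    have hUF : IsForestCfg (X₁ ∪ {s(o, c)}) := by
      rw [union_singleton]; exact (isForestCfg_insert_iff hoc hocX).2 ⟨hX₁F, fun h => hoc (hXd o ho3 c hc3 h)⟩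
    refine isForestCfg_union_of_rank_le_one hop hoq hpq hU hZon hUZ (nZ o p ho3 hp3) (nZ o q ho3 hq3) (nZ p q hp3 hq3) hUF hZF hZop
      (fun h => absurd h hZoq) (fun _ => ⟨?_, ?_⟩)
    · rintro (h | h)
      · exact nX p q hp3 hq3 h
      · rcases Sym2.eq_iff.1 (mem_singleton_iff.1 h) with ⟨h1, -⟩ | ⟨-, h2⟩
        · exact hop h1.symm
        · exact hoq h2.symm
    · -- `X₁ ∪ {oc, pq}` is a forest: a path with apex `c` (`c = p`: `{po, pq}`; `c = q`: `{qo, qp}`) on the discrete `X₁`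
      rw [union_singleton]
      rcases hc with rfl | rfl
      · have : insert (s(c, q)) (insert (s(o, c)) X₁) = ({s(c, o), s(c, q)} : Set (Sym2 V)) ∪ X₁ := by
          rw [insert_union, singleton_union, insert_comm, Sym2.eq_swap (a := o)]
        rw [this]
        refine (isForestCfg_pairPath_union_iff hop.symm hpq hoq (by rw [Sym2.eq_swap]; exact nX o c ho3 hp3) (nX c q hp3 hq3)).2
          ⟨hX₁F, fun x hx x' hx' hxx' => hXd x ?_ x' ?_ hxx'⟩
        · simp only [mem_insert_iff, mem_singleton_iff] at hx ⊢; tauto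
        · simp only [mem_insert_iff, mem_singleton_iff] at hx' ⊢; tauto
      · have : insert (s(p, c)) (insert (s(o, c)) X₁) = ({s(c, o), s(c, p)} : Set (Sym2 V)) ∪ X₁ := by
          rw [insert_union, singleton_union, insert_comm, Sym2.eq_swap (a := o), Sym2.eq_swap (a := p)]
        rw [this]
        refine (isForestCfg_pairPath_union_iff hoq.symm hpq.symm hop (by rw [Sym2.eq_swap]; exact nX o c ho3 hq3)
          (by rw [Sym2.eq_swap]; exact nX p c hp3 hq3)).2 ⟨hX₁F, fun x hx x' hx' hxx' => hXd x ?_ x' ?_ hxx'⟩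
        · simp only [mem_insert_iff, mem_singleton_iff] at hx ⊢; tauto
        · simp only [mem_insert_iff, mem_singleton_iff] at hx' ⊢; tauto
  · -- `X₁` joins exactly `p, q`, `Z` discrete: free gluing
    have hUF : IsForestCfg (X₁ ∪ {s(o, c)}) := by
      rw [union_singleton]
      refine (isForestCfg_insert_iff hoc hocX).2 ⟨hX₁F, ?_⟩
      rcases hc with rfl | rfl
      exacts [hXop, hXoq]
    exact isForestCfg_union_of_sep hop hoq hpq hU hZon hUZ (nZ o p ho3 hp3) (nZ o q ho3 hq3) hUF hZF hZd

/-- **A fibre count is bounded by another along an injection.** [cite: Linusson2011, Prop. 2.6] -/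
theorem fibreCount_le_of_injOn {Mf u Mf' u' : BondConfig V} {A B A' B' : Set (BondConfig V)} (φ : BondConfig V → BondConfig V)
    (hmap : ∀ ω, ω \ Mf = u → ω ∈ A → ω ∆ Mf ∈ B → φ ω \ Mf' = u' ∧ φ ω ∈ A' ∧ (φ ω) ∆ Mf' ∈ B')
    (hinj : ∀ ω ω', ω \ Mf = u → ω ∈ A → ω ∆ Mf ∈ B → ω' \ Mf = u → ω' ∈ A → ω' ∆ Mf ∈ B → φ ω = φ ω' → ω = ω') :
    fibreCount Mf u A B ≤ fibreCount Mf' u' A' B' := by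
  unfold fibreCount
  refine Finset.card_le_card_of_injOn φ (fun ω hω => ?_) (fun ω hω ω' hω' h => ?_)
  · rw [Finset.mem_coe, Finset.mem_filter] at hω ⊢
    exact ⟨Finset.mem_univ _, hmap ω hω.2.1 hω.2.2.1 hω.2.2.2⟩
  · rw [Finset.mem_coe, Finset.mem_filter] at hω hω'
    exact hinj ω ω' hω.2.1 hω.2.2.1 hω.2.2.2 hω'.2.1 hω'.2.2.1 hω'.2.2.2 h


end PathGadgetReglue

end FK

end Summit.CriticalPhenomena.PercolationContinuityZ3.Theorems

end
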